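import Mathlib
import Summits.ValiantsHypothesis.ValiantsHypothesis.Theorems.NewtonTauWeak.Negative.Zonogon
import Summits.ValiantsHypothesis.ValiantsHypothesis.Theorems.NewtonUnitEquationsNewtonTauWeakHexagonSeparated
import Summits.ValiantsHypothesis.ValiantsHypothesis.Theorems.NewtonUnitEquationsNewtonTauWeakHexagonTransfer
import Summits.ValiantsHypothesis.ValiantsHypothesis.Theorems.NewtonUnitEquationsNewtonTauWeakHexagonThree
import Summits.ValiantsHypothesis.ValiantsHypothesis.Theorems.NewtonUnitEquationsNewtonTauWeakHexagonDirections
import Summits.ValiantsHypothesis.ValiantsHypothesis.Theorems.NewtonUnitEquationsNewtonTauWeakHexagonAllK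

/-!
# `NewtonUnitEquationsNewtonTauWeakHexagonAllKCorollaries` — T2 at every fixed `K` on three lines

Rung toward `stub_binomialNewtonTauCommon` (T2 = KPTT Conj. 1 at `t = 2`; crux `NewtonTauWeak`,
stmt-ValiantsHypothesis-5904), line `binomial-normal-form`, lead c3 (card
`Cruxes/NewtonTauWeak/Lines/binomial-normal-form-delta-global.md` §2).

* `hex_binomialCommon_rays_allK`: for every `K` and every common exponent list inside `ℕ(1,0) ∪ ℕ(0,1) ∪ ℕ(1,1)`,
  `vert(Σ_{l<K} c_l Π_j (1 - ρ_{lj}X^{d_j})) ≤ 4 + 4K(K+1)(8 + 8·K!·2^{K·K})` (group the factors by ray;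
  `hex_vert_sum_hexagon_le_allK`).
* `hex_binomialCommon_directions_allK`: the same on ANY three lines (`uM` in the cone of the independent `uL, uR`),
  by transfer (`hex_vert_transfer`) along `± diag(rR rM, rL rM)·adj[uL uR]`.
So at every FIXED `K` no exponent list on `≤ 3` lines — whatever the multiplicities, scales (digit frames) and
coincidences — refutes T2; together with `hex_binomialCommon_two_directions` (two lines, `≤ 4K`). [folklore]
-/

set_option linter.dupNamespace false

noncomputable section

namespace Summit.ValiantsHypothesis.ValiantsHypothesis.Theorems.NewtonUnitEquationsNewtonTauWeak

open scoped BigOperators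
open MvPolynomial
open Summit.ValiantsHypothesis.ValiantsHypothesis.Theorems.NewtonTauWeak.Negative (vert)

/-- **T2 at every fixed `K` on the three model rays.** For every `K` and every common exponent list inside
`ℕ(1,0) ∪ ℕ(0,1) ∪ ℕ(1,1)`, the binomial sum of `K` products has at most `4 + 4K(K+1)(8 + 8·K!·2^{K·K})` Newton
vertices — uniformly in `N`, the exponents and the coefficients (group factors by ray; `hex_vert_sum_hexagon_le_allK`).
[folklore] -/
theorem hex_binomialCommon_rays_allK (K N : ℕ) (c : Fin K → ℂ) (ρ : Fin K → Fin N → ℂ)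
    (d : Fin N → (Fin 2 →₀ ℕ)) (hd : ∀ j, (d j) 1 = 0 ∨ (d j) 0 = 0 ∨ (d j) 0 = (d j) 1) :
    vert (∑ l, C (c l) * ∏ j, (1 - C (ρ l j) * monomial (d j) 1)) ≤
      4 + 4 * K * (K + 1) * (8 + 8 * (Nat.factorial K * 2 ^ (K * K))) := by
  classical
  set fac : Fin K → Fin N → MvPolynomial (Fin 2) ℂ := fun l j => 1 - C (ρ l j) * monomial (d j) 1
    with hfac
  set px : Fin N → Prop := fun j => (d j) 1 = 0 with hpx
  set py : Fin N → Prop := fun j => (d j) 0 = 0 with hpy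
  set X : Fin K → MvPolynomial (Fin 2) ℂ := fun l => C (c l) * ∏ j ∈ Finset.univ.filter px, fac l j
    with hX
  set Y : Fin K → MvPolynomial (Fin 2) ℂ := fun l =>
    ∏ j ∈ (Finset.univ.filter fun j => ¬ px j).filter py, fac l j with hY
  set D : Fin K → MvPolynomial (Fin 2) ℂ := fun l =>
    ∏ j ∈ (Finset.univ.filter fun j => ¬ px j).filter (fun j => ¬ py j), fac l j with hD
  have hsplit : ∀ l, C (c l) * ∏ j, fac l j = X l * Y l * D l := by
    intro l
    simp only [hX, hY, hD]
    rw [← Finset.prod_filter_mul_prod_filter_not Finset.univ px,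
      ← Finset.prod_filter_mul_prod_filter_not (Finset.univ.filter fun j => ¬ px j) py]
    ring
  have hsum : (∑ l, C (c l) * ∏ j, (1 - C (ρ l j) * monomial (d j) 1)) = ∑ l, X l * Y l * D l :=
    Finset.sum_congr rfl fun l _ => hsplit l
  rw [hsum]
  have hfx : ∀ l, ∀ j ∈ Finset.univ.filter px, ∀ e ∈ (fac l j).support, e 1 = 0 := by
    intro l j hj e he
    rcases HexagonThree.mem_support_binomial he with rfl | rfl
    · rfl
    · exact (Finset.mem_filter.mp hj).2
  have hfy : ∀ l, ∀ j ∈ (Finset.univ.filter fun j => ¬ px j).filter py, ∀ e ∈ (fac l j).support,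
      e 0 = 0 := by
    intro l j hj e he
    rcases HexagonThree.mem_support_binomial he with rfl | rfl
    · rfl
    · exact (Finset.mem_filter.mp hj).2
  have hfd : ∀ l, ∀ j ∈ (Finset.univ.filter fun j => ¬ px j).filter (fun j => ¬ py j),
      ∀ e ∈ (fac l j).support, e 0 = e 1 := by
    intro l j hj e he
    rcases HexagonThree.mem_support_binomial he with rfl | rfl
    · rfl
    · obtain ⟨hj1, hj2⟩ := Finset.mem_filter.mp hj
      have hj1' := (Finset.mem_filter.mp hj1).2
      rcases hd j with h | h | h
      · exact absurd h hj1'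
      · exact absurd h hj2
      · exact h
  refine hex_vert_sum_hexagon_le_allK K X Y D (fun l => ?_) (fun l => ?_) (fun l => ?_)
  · intro e he
    obtain ⟨a, ha, b, hb, rfl⟩ := Finset.mem_add.mp (support_mul _ _ he)
    rw [← monomial_zero'] at ha
    have ha0 : a = 0 := Finset.mem_singleton.mp (support_monomial_subset ha)
    have hb1 : b 1 = 0 := HexagonThree.support_prod_induction _ _ (fun e => e 1 = 0) rfl
      (fun p q hp hq => hex_xonly_mul p q hp hq) (hfx l) b hb
    simp [ha0, hb1]
  · exact HexagonThree.support_prod_induction _ _ (fun e => e 0 = 0) rfl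
      (fun p q hp hq => hex_yonly_mul p q hp hq) (hfy l)
  · exact HexagonThree.support_prod_induction _ _ (fun e => e 0 = e 1) rfl
      (fun p q hp hq => hex_diag_mul p q hp hq) (hfd l)

/-- **Fixed-`K` form.** For every `K` there is a constant `C_K` bounding the Newton vertices of every binomial sum of `K`
products over a common exponent list on the three model rays — the `FixedKCoincidence` shape of T2, settled for
exponent lists on three lines (any `N`, any multiplicities and coincidences). [folklore] -/
theorem hex_fixedK_three_rays (K : ℕ) :
    ∃ B : ℕ, ∀ (N : ℕ) (c : Fin K → ℂ) (ρ : Fin K → Fin N → ℂ) (d : Fin N → (Fin 2 →₀ ℕ)),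
      (∀ j, (d j) 1 = 0 ∨ (d j) 0 = 0 ∨ (d j) 0 = (d j) 1) →
        vert (∑ l, C (c l) * ∏ j, (1 - C (ρ l j) * monomial (d j) 1)) ≤ B :=
  ⟨_, fun N c ρ d hd => hex_binomialCommon_rays_allK K N c ρ d hd⟩

open HexagonDirections in
/-- **T2 at every fixed `K` on any three lines.** Same hypotheses as `hex_binomialCommon_three_directions`
(`uM` in the cone of the independent `uL, uR`), for `K` products: `vert ≤ 4 + 4K(K+1)(8 + 8·K!·2^{K·K})`, by
transfer (`hex_vert_transfer`) to the model rays and `hex_binomialCommon_rays_allK`. [folklore] -/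
theorem hex_binomialCommon_directions_allK (K N : ℕ) (c : Fin K → ℂ) (ρ : Fin K → Fin N → ℂ)
    (d : Fin N → (Fin 2 →₀ ℕ)) (uL uR uM : Fin 2 →₀ ℕ) (rL rR rM : ℕ) (hrL : 0 < rL) (hrR : 0 < rR)
    (hrM : 0 < rM) (hrel : rM • uM = rL • uL + rR • uR) (hind : uL 0 * uR 1 ≠ uL 1 * uR 0)
    (hd : ∀ j, (∃ k : ℕ, d j = k • uL) ∨ (∃ k : ℕ, d j = k • uR) ∨ (∃ k : ℕ, d j = k • uM)) :
    vert (∑ l, C (c l) * ∏ j, (1 - C (ρ l j) * monomial (d j) 1)) ≤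
      4 + 4 * K * (K + 1) * (8 + 8 * (Nat.factorial K * 2 ^ (K * K))) := by
  classical
  -- integer data
  set D : ℤ := ((uL 0 : ℕ) : ℤ) * ((uR 1 : ℕ) : ℤ) - ((uL 1 : ℕ) : ℤ) * ((uR 0 : ℕ) : ℤ) with hD
  have hD0 : D ≠ 0 := by
    intro h
    apply hind
    have : ((uL 0 : ℕ) : ℤ) * (uR 1 : ℕ) = ((uL 1 : ℕ) : ℤ) * (uR 0 : ℕ) := by linarith
    exact_mod_cast this
  set σ : ℤ := Int.sign D with hσ
  have hσD : σ * D = |D| := Int.sign_mul_self_eq_abs D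
  have hσ0 : σ ≠ 0 := fun h' => hD0 (Int.sign_eq_zero_iff_zero.mp h')
  set nD : ℕ := D.natAbs with hnD
  have hnD' : ((nD : ℕ) : ℤ) = |D| := Int.natCast_natAbs D
  -- the target exponents
  set vL : Fin 2 →₀ ℕ := Finsupp.single 0 (rR * rM * nD) with hvL
  set vR : Fin 2 →₀ ℕ := Finsupp.single 1 (rL * rM * nD) with hvR
  set vM : Fin 2 →₀ ℕ := Finsupp.single 0 (rL * rR * nD) + Finsupp.single 1 (rL * rR * nD) with hvM
  set d' : Fin N → (Fin 2 →₀ ℕ) := fun j =>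
    if h₁ : ∃ k : ℕ, d j = k • uL then Classical.choose h₁ • vL
    else if h₂ : ∃ k : ℕ, d j = k • uR then Classical.choose h₂ • vR
    else if h₃ : ∃ k : ℕ, d j = k • uM then Classical.choose h₃ • vM else 0 with hd'
  -- the real linear map
  set a : ℝ := ((uL 0 : ℕ) : ℝ) with ha
  set b : ℝ := ((uL 1 : ℕ) : ℝ) with hb
  set c' : ℝ := ((uR 0 : ℕ) : ℝ) with hc'
  set e : ℝ := ((uR 1 : ℕ) : ℝ) with he
  set α : ℝ := ((σ : ℤ) : ℝ) * (rR : ℝ) * (rM : ℝ) with hα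
  set β : ℝ := ((σ : ℤ) : ℝ) * (rL : ℝ) * (rM : ℝ) with hβ
  obtain ⟨L, hL⟩ := exists_linearMap a b c' e α β
  have hdetR : a * e - b * c' ≠ 0 := by
    have h : ((D : ℤ) : ℝ) ≠ 0 := by exact_mod_cast hD0
    have hDR : ((D : ℤ) : ℝ) = a * e - b * c' := by rw [hD]; push_cast; ring
    rwa [hDR] at h
  have hσR : ((σ : ℤ) : ℝ) ≠ 0 := by exact_mod_cast hσ0
  have hαR : α ≠ 0 := by positivity
  have hβR : β ≠ 0 := by positivity
  have hLinj : Function.Injective L := injective_of_det hαR hβR hdetR L hL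
  -- images of the three directions
  set emb : (Fin 2 →₀ ℕ) → (Fin 2 → ℝ) := fun v i => ((v i : ℕ) : ℝ) with hemb
  have hσDR : ((σ : ℤ) : ℝ) * (a * e - b * c') = (nD : ℝ) := by
    have h1 : (((σ * D : ℤ)) : ℝ) = ((|D| : ℤ) : ℝ) := by rw [hσD]
    have h2 : ((nD : ℕ) : ℝ) = ((|D| : ℤ) : ℝ) := by exact_mod_cast hnD'
    rw [h2, ← h1, hD]; push_cast; ring
  have huL : emb uL = ![a, b] := by
    ext i; fin_cases i <;> simp [hemb, ha, hb]
  have huR : emb uR = ![c', e] := by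
    ext i; fin_cases i <;> simp [hemb, hc', he]
  have hvL' : emb vL = ![(rR : ℝ) * (rM : ℝ) * (nD : ℝ), 0] := by
    ext i; fin_cases i <;> simp [hemb, hvL]
  have hvR' : emb vR = ![0, (rL : ℝ) * (rM : ℝ) * (nD : ℝ)] := by
    ext i; fin_cases i <;> simp [hemb, hvR]
  have hvM' : emb vM = ![(rL : ℝ) * (rR : ℝ) * (nD : ℝ), (rL : ℝ) * (rR : ℝ) * (nD : ℝ)] := by
    ext i; fin_cases i <;> simp [hemb, hvM]
  have hLuL : L (emb uL) = emb vL := by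
    rw [huL, hL, hvL']
    ext i; fin_cases i
    · simp only [Fin.zero_eta, Matrix.cons_val_zero, Matrix.cons_val_one, Matrix.cons_val_fin_one]
      rw [← hσDR, hα]; ring
    · simp only [Fin.mk_one, Matrix.cons_val_zero, Matrix.cons_val_one, Matrix.cons_val_fin_one]
      ring
  have hLuR : L (emb uR) = emb vR := by
    rw [huR, hL, hvR']
    ext i; fin_cases i
    · simp only [Fin.zero_eta, Matrix.cons_val_zero, Matrix.cons_val_one, Matrix.cons_val_fin_one]
      ring
    · simp only [Fin.mk_one, Matrix.cons_val_zero, Matrix.cons_val_one, Matrix.cons_val_fin_one]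
      rw [← hσDR, hβ]; ring
  have hembM : (rM : ℝ) • emb uM = (rL : ℝ) • emb uL + (rR : ℝ) • emb uR := by
    ext i
    have h := DFunLike.congr_fun hrel i
    simp only [Finsupp.smul_apply, Finsupp.add_apply, smul_eq_mul] at h
    simp only [hemb, Pi.smul_apply, Pi.add_apply, smul_eq_mul]
    exact_mod_cast h
  have hLuM : L (emb uM) = emb vM := by
    have hrM' : (rM : ℝ) ≠ 0 := by exact_mod_cast hrM.ne'
    have h : (rM : ℝ) • L (emb uM) = (rM : ℝ) • emb vM := by
      rw [← map_smul, hembM, map_add, map_smul, map_smul, hLuL, hLuR, hvL', hvR', hvM']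
      ext i; fin_cases i
      · simp only [Fin.zero_eta, Pi.add_apply, Pi.smul_apply, Matrix.cons_val_zero, smul_eq_mul]; ring
      · simp only [Fin.mk_one, Pi.add_apply, Pi.smul_apply, Matrix.cons_val_one, Matrix.cons_val_fin_one,
          smul_eq_mul]; ring
    exact smul_right_injective _ hrM' h
  have hemb_smul : ∀ (k : ℕ) (v : Fin 2 →₀ ℕ), emb (k • v) = (k : ℝ) • emb v := by
    intro k v; ext i; simp [hemb]
  -- `L` carries `d j` to `d' j`, and `d' j` lies on one of the three model rays
  have hLd : ∀ j, L (emb (d j)) = emb (d' j) := by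
    intro j
    simp only [hd']
    by_cases h₁ : ∃ k : ℕ, d j = k • uL
    · rw [dif_pos h₁]
      conv_lhs => rw [Classical.choose_spec h₁]
      rw [hemb_smul, map_smul, hLuL, hemb_smul]
    · rw [dif_neg h₁]
      by_cases h₂ : ∃ k : ℕ, d j = k • uR
      · rw [dif_pos h₂]
        conv_lhs => rw [Classical.choose_spec h₂]
        rw [hemb_smul, map_smul, hLuR, hemb_smul]
      · rw [dif_neg h₂]
        have h₃ : ∃ k : ℕ, d j = k • uM := by
          rcases hd j with h | h | h
          · exact absurd h h₁
          · exact absurd h h₂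
          · exact h
        rw [dif_pos h₃]
        conv_lhs => rw [Classical.choose_spec h₃]
        rw [hemb_smul, map_smul, hLuM, hemb_smul]
  have hrays : ∀ j, (d' j) 1 = 0 ∨ (d' j) 0 = 0 ∨ (d' j) 0 = (d' j) 1 := by
    intro j
    simp only [hd']
    split_ifs
    · left; simp [hvL]
    · right; left; simp [hvR]
    · right; right; simp [hvM]
    · left; simp
  rw [hex_vert_transfer K N c ρ d d' L hLinj hLd]
  exact hex_binomialCommon_rays_allK K N c ρ d' hrays



end Summit.ValiantsHypothesis.ValiantsHypothesis.Theorems.NewtonUnitEquationsNewtonTauWeak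

end
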